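import Mathlib
import HarnessLib
import Summits.BirchSwinnertonDyer.BirchSwinnertonDyer.Theses.ByReductionTypeAtTwo
import Summits.BirchSwinnertonDyer.BirchSwinnertonDyer.Theorems.ByReductionTypeAtTwoRankOneAtTwoOneDoorLawDefs

/-!
# Sketch — crux-ideate g4 (ideator 1/2) on `RankOneAtTwoOffBigImageOddLocal` (stmt-…-23716)

Card `shimura-carrier-transfer-at-two` (Jacquet–Langlands carrier transfer at `p = 2`).
BSD is NOT proved here; nothing in this file proves the crux.  This file only TYPES the objects
the card talks about, over existing declarations, and proves the elementary valuation lemma R0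
that places the γ₂ strata inside the card's habitat.

* §1 R0 (proved): on the S₃-strata γ₂a/γ₂c/γ₂d (and γ₁) — `±Δ` or `±2Δ` a rational square — the
  valuation `v_ℓ(Δ)` is EVEN at every odd prime `ℓ`; so every odd multiplicative prime there has
  fibre `I_{2k}` and EVEN Tamagawa number (`c_ℓ = 2k` split, `2` non-split): it is a CARRIER.
* §2 Typed vocabulary: local Tamagawa number at a rational prime, carriers, the JL-absorbing set
  `S = N⁻` (even cardinality, odd multiplicative primes, all carriers but ≤ 1 inside), the
  Shimura–Heegner field condition (primes of `S` inert, the other bad primes split).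
* §3 The first lemma of the line as a `Prop` (statement only): `CarrierParityAtOddMultiplicative`
  (Tate's algorithm: at an odd multiplicative prime `2 ∣ c_ℓ ↔ 2 ∣ v_ℓ(Δ_min)`), and the numerical
  shadow of the Ribet–Takahashi degree relation at `2` as a predicate on a pair
  (modular parametrisation datum, posited Shimura shadow) — the posited object is an honest
  hypothesis structure; its CONSTRUCTION is the card's definition request D1.
-/

set_option autoImplicit false
set_option linter.dupNamespace false

noncomputable section

open scoped Classical

open Literature.NumberTheory.EllipticCurves Literature.NumberTheory.EllipticCurves.ModularForms NumberField
  Summit.BirchSwinnertonDyer.BirchSwinnertonDyer.Theorems.RankOneAtTwoOneDoor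

namespace Summit.BirchSwinnertonDyer.BirchSwinnertonDyer.Cruxes.RankOneAtTwoOffBigImageOddLocal.ShimuraCarrierTransfer

/-! ### §1 R0 — even valuation of the discriminant on the γ strata (proved) -/

/-- If `u * Δ` is a square in `ℚ` with `u ≠ 0`, `v_ℓ(u) = 0` and `Δ ≠ 0`, then `v_ℓ(Δ)` is even. -/
theorem even_padicValRat_of_isSquare_mul (ℓ : ℕ) [Fact ℓ.Prime] {u Δ : ℚ} (hu : u ≠ 0)
    (hΔ : Δ ≠ 0) (hval : padicValRat ℓ u = 0) (hsq : IsSquare (u * Δ)) :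
    Even (padicValRat ℓ Δ) := by
  obtain ⟨r, hr⟩ := hsq
  have hr0 : r ≠ 0 := by
    rintro rfl
    simp [hu, hΔ] at hr
  have h1 : padicValRat ℓ (u * Δ) = padicValRat ℓ u + padicValRat ℓ Δ := padicValRat.mul hu hΔ
  have h2 : padicValRat ℓ (r * r) = padicValRat ℓ r + padicValRat ℓ r := padicValRat.mul hr0 hr0
  rw [hr] at h1
  rw [hval, zero_add] at h1
  exact ⟨padicValRat ℓ r, by rw [← h1, h2]⟩

/-- `v_ℓ(-1) = 0`. -/
theorem padicValRat_neg_one (ℓ : ℕ) : padicValRat ℓ (-1 : ℚ) = 0 := by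
  rw [padicValRat.neg]; simp

/-- `v_ℓ(2) = 0` for an odd prime `ℓ`. -/
theorem padicValRat_two_of_ne (ℓ : ℕ) [hℓ : Fact ℓ.Prime] (h2 : ℓ ≠ 2) :
    padicValRat ℓ (2 : ℚ) = 0 := by
  have : padicValRat ℓ ((2 : ℕ) : ℚ) = padicValNat ℓ 2 := padicValRat.of_nat
  rw [show ((2 : ℕ) : ℚ) = 2 by norm_num] at this
  rw [this]
  have : padicValNat ℓ 2 = 0 := by
    apply padicValNat.eq_zero_of_not_dvd
    intro hdvd
    have := (Nat.prime_dvd_prime_iff_eq hℓ.out Nat.prime_two).mp hdvd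
    exact h2 this
  simp [this]

/-- `v_ℓ(-2) = 0` for an odd prime `ℓ`. -/
theorem padicValRat_neg_two_of_ne (ℓ : ℕ) [Fact ℓ.Prime] (h2 : ℓ ≠ 2) :
    padicValRat ℓ (-2 : ℚ) = 0 := by
  rw [show (-2 : ℚ) = -(2 : ℚ) by ring, padicValRat.neg]
  exact padicValRat_two_of_ne ℓ h2

/-- **R0.** On the γ strata of the off-slice locus (`Δ`, `−Δ`, `2Δ` or `−2Δ` a rational square —
the disjuncts of the tree theorem `not_forall_hasSurjectiveModNGaloisRep_two_pow_iff` other than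
rational `2`-torsion and the `j = −4t³(t+8)` family), the discriminant has EVEN valuation at every
odd prime `ℓ`.  With Tate's algorithm (`CarrierParityAtOddMultiplicative` below) every odd
multiplicative prime of such a curve is a `2`-carrier. -/
theorem even_padicValRat_delta_of_gamma (ℓ : ℕ) [Fact ℓ.Prime] (h2 : ℓ ≠ 2) {Δ : ℚ} (hΔ : Δ ≠ 0)
    (h : IsSquare Δ ∨ IsSquare (-Δ) ∨ IsSquare (2 * Δ) ∨ IsSquare (-(2 * Δ))) :
    Even (padicValRat ℓ Δ) := by
  rcases h with h | h | h | h
  · exact even_padicValRat_of_isSquare_mul ℓ one_ne_zero hΔ (by simp) (by simpa using h)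
  · exact even_padicValRat_of_isSquare_mul ℓ (u := -1) (by norm_num) hΔ (padicValRat_neg_one ℓ)
      (by simpa using h)
  · exact even_padicValRat_of_isSquare_mul ℓ (u := 2) (by norm_num) hΔ (padicValRat_two_of_ne ℓ h2) h
  · exact even_padicValRat_of_isSquare_mul ℓ (u := -2) (by norm_num) hΔ
      (padicValRat_neg_two_of_ne ℓ h2) (by simpa [neg_mul] using h)

/-- R0 for a Weierstrass curve: specialisation of `even_padicValRat_delta_of_gamma` to `W.Δ`
(for a globally minimal `W` this is `v_ℓ(Δ_min)`). -/
theorem even_padicValRat_weierstrassDelta_of_gamma (W : WeierstrassCurve ℚ) [W.IsElliptic]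
    (ℓ : ℕ) [Fact ℓ.Prime] (h2 : ℓ ≠ 2)
    (h : IsSquare W.Δ ∨ IsSquare (-W.Δ) ∨ IsSquare (2 * W.Δ) ∨ IsSquare (-(2 * W.Δ))) :
    Even (padicValRat ℓ W.Δ) :=
  even_padicValRat_delta_of_gamma ℓ h2 (W.coe_Δ' ▸ W.Δ'.ne_zero) h

/-! ### §2 Typed vocabulary of the card -/

/-- The local Tamagawa number `c_ℓ(W)` at a rational prime `ℓ`, computed `ℓ`-adically
(the factor of `W.tamagawaProduct`, by the named fact `localTamagawaNumber_padic_eq`). -/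
def cAt (W : WeierstrassCurve ℚ) (ℓ : ℕ) [Fact ℓ.Prime] : ℕ :=
  (W.baseChange ℚ_[ℓ]).localTamagawaNumber ℤ_[ℓ]

/-- `ℓ` is a **`2`-carrier** of `W`: a prime with even local Tamagawa number. -/
def IsCarrier (W : WeierstrassCurve ℚ) (ℓ : ℕ) : Prop :=
  ∃ _ : Fact ℓ.Prime, 2 ∣ cAt W ℓ

/-- `ℓ` is an odd prime of multiplicative reduction of `W`. -/
def IsOddMultiplicative (W : WeierstrassCurve ℚ) (ℓ : ℕ) : Prop :=
  ∃ _ : Fact ℓ.Prime, ℓ ≠ 2 ∧ W.HasMultiplicativeReductionAtPrime ℓ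

/-- **The JL-absorbing set.** `S` (the future `N⁻` of the Shimura curve `X^{S}_0(N/∏S)`) is a
finite set of ODD MULTIPLICATIVE primes of `W` of EVEN cardinality (indefinite quaternion algebra
over `ℚ` ramified exactly at `S`) such that AT MOST ONE `2`-carrier of `W` lies outside `S`
(so the `N⁺`-side of the Kolyvagin argument sees `σ⁺ ≤ max`, the one-carrier regime of
Jetchev's Thm. 1.4 / Cor. 1.5). -/
def JLAbsorbs (W : WeierstrassCurve ℚ) (S : Finset ℕ) : Prop :=
  Even S.card ∧ (∀ ℓ ∈ S, IsOddMultiplicative W ℓ) ∧ {ℓ : ℕ | IsCarrier W ℓ ∧ ℓ ∉ S}.Subsingleton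

/-- **Habitat of the card**: some JL-absorbing set exists (all `2`-carriers but at most one are
odd multiplicative, and the parity of `#S` can be fixed — if necessary by adding one odd
multiplicative NON-carrier, or by leaving one carrier on the `N⁺` side). -/
def InJLHabitat (W : WeierstrassCurve ℚ) : Prop :=
  ∃ S : Finset ℕ, JLAbsorbs W S

/-- **Shimura–Heegner field condition** for the pair `(N, S)`: `K` imaginary quadratic, every
prime of `S` INERT in `K`, every other prime of `N` SPLIT in `K` (two primes above it) — the
generalised Heegner hypothesis making `sign L(E/K, s) = −1` with the quaternion algebra ramified
at `S` (Bertolini–Darmon 1996 §2; W. Zhang 2014 (1.2)–(1.4) with `N⁻ = ∏ S`). -/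
def IsShimuraHeegnerField (N : ℕ) (S : Finset ℕ) (K : Type) [Field K] [NumberField K] : Prop :=
  IsImaginaryQuadratic K ∧
    (∀ ℓ ∈ S, (Ideal.span {(ℓ : 𝓞 K)}).IsPrime) ∧
    (∀ p : ℕ, p.Prime → p ∣ N → p ∉ S → ((Ideal.span {(p : ℤ)}).primesOver (𝓞 K)).ncard = 2)

/-! ### §3 First lemma (statement) and the Ribet–Takahashi shadow at `2` -/

/-- **FL1 `CarrierParityAtOddMultiplicative`** (Tate's algorithm, fibre `I_n`: `c = n` if split,
`c = gcd(2, n)` if non-split; Silverman ATAEC IV.9.4 Step 2, App. C.15): at an odd multiplicative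
prime of a globally minimal `W`, the Tamagawa number is even iff `n = v_ℓ(Δ_min)` is even.
Combined with R0: on the γ strata EVERY odd multiplicative prime is a carrier; on δ the carriers
are the odd multiplicative primes at which `E[2]` is unramified (`v_ℓ(Δ)` even). -/
def CarrierParityAtOddMultiplicative : Prop :=
  ∀ (W : WeierstrassCurve ℚ) [W.IsElliptic] [W.IsGloballyMinimal] (ℓ : ℕ) [Fact ℓ.Prime],
    ℓ ≠ 2 → W.HasMultiplicativeReductionAtPrime ℓ → (2 ∣ cAt W ℓ ↔ Even (padicValRat ℓ W.Δ))

/-- **Posited object (definition request D1): the numerical shadow of a Shimura-curve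
parametrisation** of (the isogeny class of) `W` by `X^{S}_0(N⁺)`, `N⁺ = N/∏S`: the degree of an
optimal quotient map `J^{S}_0(N⁺) → E'` and, for a Shimura–Heegner field `K`, the trace
`y⁻_K ∈ E(K)` of a CM point by `𝓞_K` under a minimal-degree morphism `X^{S}_0(N⁺) → E`
(Chai–Shan–Tian's `f` «mapping a Hodge class to torsion»).  HONEST HYPOTHESIS STRUCTURE: no field
constrains the data; every statement of the card quantifies over THE shadow produced by the
construction item D1, never over all shadows. -/
structure ShimuraShadow (W : WeierstrassCurve ℚ) (S : Finset ℕ) (K : Type) [Field K]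
    [NumberField K] where
  /-- degree of the optimal Shimura-curve parametrisation `J^{S}_0(N⁺) → E'` -/
  deg : ℕ
  deg_pos : 0 < deg
  /-- `2`-adic valuation of the Hodge-class denominator used to map `X^{S}_0(N⁺)` into its
  Jacobian (no cusps on a Shimura curve); enters the door law as an explicit shift -/
  hodgeShift : ℕ
  /-- the Shimura-curve Heegner point `y⁻_K ∈ E(K)` -/
  yK : (W.baseChange K).toAffine.Point

/-- **K1 shadow `RibetTakahashiValuationAtTwo`** — the `2`-ADIC PART of the Ribet–Takahashi /
Takahashi degree relation `deg φ_{N} / deg φ_{N⁺,N⁻} = ∏_{ℓ ∣ N⁻} n_ℓ` (`n_ℓ = v_ℓ(Δ_min) = c_ℓ`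
at a split carrier), as a predicate on the pair (modular parametrisation datum `Dt` of level `N`,
Shimura shadow `U` for `S = N⁻`): `v₂(deg Dt) = v₂(deg U) + Σ_{ℓ ∈ S} v₂(n_ℓ)`.  In print with
`2` included for `N` squarefree and `E[l]` irreducible for all `l` (Takahashi 2001, Cor. 3.5 via
Thm. 2.7 at `l = 2`); the card's K1 asserts it for the ACTUAL data on the habitat. -/
def RibetTakahashiValuationAtTwo (W : WeierstrassCurve ℚ) [W.IsElliptic] {N : ℕ} [NeZero N]
    (Dt : ModularParametrizationData W N) (S : Finset ℕ) {K : Type} [Field K] [NumberField K]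
    (U : ShimuraShadow W S K) : Prop :=
  padicValNat 2 Dt.deg = padicValNat 2 U.deg + ∑ ℓ ∈ S, padicValNat 2 (padicValRat ℓ W.Δ).toNat

/-! ### §4 The `N⁺`-side shift and «Σ⁺ = max⁺» (proved), the Shimura door-law SHAPE (typed) -/

/-- `c_ℓ(W)` for any natural `ℓ` (junk value `1` off primes), so that it can be summed over a `Finset`. -/
def cAt' (W : WeierstrassCurve ℚ) (ℓ : ℕ) : ℕ :=
  if h : ℓ.Prime then @cAt W ℓ ⟨h⟩ else 1

/-- **`σ⁺(W, S)`** — the `2`-adic Tamagawa SUM over the bad primes OUTSIDE `S` (the `N⁺` side); the only Tamagawa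
exponent the Kolyvagin argument on `X^{S}_0(N⁺)` has to produce (the `S`-side factors are absorbed by the
parametrisation degree, `RibetTakahashiValuationAtTwo`). -/
def sigmaPlus (W : WeierstrassCurve ℚ) (N : ℕ) (S : Finset ℕ) : ℕ :=
  ∑ ℓ ∈ N.primeFactors \ S, padicValNat 2 (cAt' W ℓ)

/-- **`max⁺(W, S)`** — the largest `2`-adic Tamagawa exponent outside `S` (what stringent local conditions certify,
barrier `StringentKolyvaginCapsAtMax`). -/
def maxPlus (W : WeierstrassCurve ℚ) (N : ℕ) (S : Finset ℕ) : ℕ :=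
  (N.primeFactors \ S).sup fun ℓ => padicValNat 2 (cAt' W ℓ)

/-- A sum over a finset whose summand is non-zero at no more than one point equals the sup. -/
theorem sum_eq_sup_of_subsingleton (T : Finset ℕ) (f : ℕ → ℕ)
    (h : {ℓ : ℕ | ℓ ∈ T ∧ f ℓ ≠ 0}.Subsingleton) : ∑ ℓ ∈ T, f ℓ = T.sup f := by
  by_cases hz : ∀ ℓ ∈ T, f ℓ = 0
  · rw [Finset.sum_eq_zero hz]
    symm
    exact le_antisymm (Finset.sup_le fun ℓ hℓ => (hz ℓ hℓ).le) bot_le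
  · push_neg at hz
    obtain ⟨ℓ₀, hℓ₀, hf⟩ := hz
    have hothers : ∀ ℓ ∈ T, ℓ ≠ ℓ₀ → f ℓ = 0 := by
      intro ℓ hℓ hne
      by_contra hfl
      exact hne (h ⟨hℓ, hfl⟩ ⟨hℓ₀, hf⟩)
    rw [Finset.sum_eq_single ℓ₀ (fun ℓ hℓ hne => hothers ℓ hℓ hne) (fun hn => absurd hℓ₀ hn)]
    apply le_antisymm (Finset.le_sup hℓ₀)
    apply Finset.sup_le
    intro ℓ hℓ
    by_cases hne : ℓ = ℓ₀
    · subst hne; exact le_rfl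
    · rw [hothers ℓ hℓ hne]; exact bot_le

/-- **R1 «Σ⁺ = max⁺» (proved): if at most one `2`-carrier of `W` lies outside `S` (the third clause of
`JLAbsorbs`), the `N⁺`-side Tamagawa SUM equals the `N⁺`-side MAX — on the `N⁺` side the located wall of every
Kolyvagin line at `2` (`Σ` vs `max`, barrier `StringentKolyvaginCapsAtMax`) is ABSENT by construction.** -/
theorem sigmaPlus_eq_maxPlus (W : WeierstrassCurve ℚ) (N : ℕ) (S : Finset ℕ)
    (h : {ℓ : ℕ | IsCarrier W ℓ ∧ ℓ ∉ S}.Subsingleton) : sigmaPlus W N S = maxPlus W N S := by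
  apply sum_eq_sup_of_subsingleton
  intro ℓ hℓ ℓ' hℓ'
  have key : ∀ q : ℕ, (q ∈ N.primeFactors \ S ∧ padicValNat 2 (cAt' W q) ≠ 0) → IsCarrier W q ∧ q ∉ S := by
    rintro q ⟨hq, hv⟩
    rw [Finset.mem_sdiff] at hq
    have hqp : q.Prime := Nat.prime_of_mem_primeFactors hq.1
    refine ⟨⟨⟨hqp⟩, ?_⟩, hq.2⟩
    have hc : cAt' W q = @cAt W q ⟨hqp⟩ := by simp [cAt', hqp]
    rw [hc] at hv
    by_contra hnd
    exact hv (padicValNat.eq_zero_of_not_dvd hnd)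
  exact h (key ℓ hℓ) (key ℓ' hℓ')

/-- **Shimura door-admissible twist parameter** for `(W, S)`: as `DoorAdmissible` (line `one_door_law`) except that `d` is
a NON-square modulo the primes of `S` (they are INERT in `K = ℚ(√d)`) and a square modulo the other odd bad primes. -/
def ShimuraDoorAdmissible (W : WeierstrassCurve ℚ) [W.IsGloballyMinimal] (S : Finset ℕ) (d : ℤ) : Prop :=
  d < 0 ∧ Squarefree d ∧ d % 8 = 1 ∧
    (∀ q : ℕ, q.Prime → (q : ℤ) ∣ d → ∀ _h : Fact q.Prime, W.HasGoodReductionAtPrime q) ∧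
    (∀ ℓ : ℕ, ℓ.Prime → ℓ ≠ 2 → ℓ ∉ S → (∀ _h : Fact ℓ.Prime, ¬ W.HasGoodReductionAtPrime ℓ) → jacobiSym d ℓ = 1) ∧
    (∀ ℓ ∈ S, jacobiSym d ℓ = -1)

/-- **K3 SHAPE `ShimuraDoorLawShape`** — line `one_door_law`'s `DoorLawCTFor` with the modular Heegner point replaced by
the Shimura-curve Heegner point `U.yK` of the shadow `U` and the Tamagawa term `2·v₂ ∏_ℓ c_ℓ` replaced by
`2·σ⁺ + 2·hodgeShift + inertShift` (the `S`-side factors `∏_{ℓ∈S} n_ℓ` having CANCELLED against the degree ratio of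
`RibetTakahashiValuationAtTwo` in the Chai–Shan–Tian explicit Gross–Zagier formula on `X^{S}_0(N⁺)`).  A PREDICATE in
`(K, U, Wd)`; the card's K3 asserts it for the D1 shadow only; `inertShift : ℕ` is the Milne-quotient constant at the
`#S` inert bad primes, to be pinned by the bookkeeping support item (expected `#S`). -/
def ShimuraDoorLawShape (W : WeierstrassCurve ℚ) [W.IsElliptic] [W.IsGloballyMinimal] (N : ℕ) (S : Finset ℕ)
    (inertShift : ℕ) (K : Type) [Field K] [NumberField K] (U : ShimuraShadow W S K)
    (Wd : WeierstrassCurve ℚ) [Wd.IsElliptic] : Prop :=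
  ∃ m : ℕ, HasTwoDivisibilityUpToTorsion W K U.yK m ∧
    2 * m + (if W.Δ < 0 then 1 else 0) =
      padicValNat 2 (Nat.card (AddCommGroup.primaryComponent W.sha 2)) +
        padicValNat 2 (Nat.card (AddCommGroup.primaryComponent Wd.sha 2)) +
        transpCount W (NumberField.discr K) + 2 * identCount W (NumberField.discr K) +
        2 * U.hodgeShift + inertShift + 2 * sigmaPlus W N S


end Summit.BirchSwinnertonDyer.BirchSwinnertonDyer.Cruxes.RankOneAtTwoOffBigImageOddLocal.ShimuraCarrierTransfer
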